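import Mathlib.Combinatorics.SimpleGraph.Connectivity.Connected
import Mathlib.Combinatorics.SimpleGraph.Subgraph
import Literature.Combinatorics.SimpleGraph.ForcedHalves
import HarnessLib

/-!
# Parts of a coloured vertex set: the switched graph on a subset and its components (toward Corneil–Goldberg 1984)

Bookkeeping layer of a simply-exponential (`C^k`) canoniser of vertex-coloured graphs in the
style of Corneil–Goldberg [CorneilGoldberg1984] / Laubner [Laubner2011, Ch. 3], written for the
discharge of `babaiLuks1983_canonicalForm` (`GraphCanonization.lean`). The canoniser recurses on
STATES `(W, c)` — a vertex subset `W ⊆ Fin k` and a colouring `c : Fin k → ℕ` read on `W` only —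
of ONE fixed graph `G` on `Fin k`; this file views such a state through the whole-type notions of
`Literature/Combinatorics/SimpleGraph/` (`IsEquitable`, `swGraph`, `Switch`; [Laubner2011,
Def. 3.2.7, Def. 3.3.2]): `within G W` (edges outside `W × W` deleted), `liftCol W c` (`c + 1` on
`W`, the reserved colour `0` off `W`: one isolated class), `cell W c v`, `IsEqui G W c` (equitable
ON `W`), `swG G W c` (the switched graph of the state; it lives on `W`, `swG_mem`), `IsConn`,
`comp G W c u` (components as finsets), `IsClosed` (unions of components). Facts the canoniser and
its analysis consume: **across a closed set, adjacency in `G` is the switch bit of the colours**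
(`adj_iff_switch_of_not_adj`, `adj_iff_adj_of_closed`; [Laubner2011, Prop. 3.3.4]); **equitability
restricts to closed sets** (`IsEqui.of_closed`); **half-degrees** in `swG`
(`IsEqui.two_mul_card_filter_adj_le`, from `halfBounded_swGraph`); singleton cells are isolated,
so **a connected state with two vertices has no singleton cell** (`IsEqui.two_le_card_cell`).
Not here: the canoniser (`GraphCanonizationScheme.lean`), refinement.

## References

* D. G. Corneil, M. K. Goldberg, *A non-factorial algorithm for canonical numbering of a graph*,
  J. Algorithms 5 (1984) 345–362. [CorneilGoldberg1984]
* B. Laubner, *The structure of graphs and new logics for the characterization of Polynomial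
  Time*, PhD thesis, HU Berlin 2011, doi:10.18452/16335, Def. 3.3.2, Prop. 3.3.4, §3.4;
  read pp. 41–53. [Laubner2011]
-/

namespace Literature.Computability.Complexity

open Literature.Combinatorics.SimpleGraph Finset

open scoped Classical

noncomputable section

namespace CGCanon

variable {k : ℕ}

/-! ### The state graph and the lifted colouring -/

/-- `G` with the edges outside `W × W` deleted (the spanning graph of the subgraph induced on
`W`). [folklore] -/
def within (G : SimpleGraph (Fin k)) (W : Finset (Fin k)) : SimpleGraph (Fin k) :=
  ((⊤ : G.Subgraph).induce (W : Set (Fin k))).spanningCoe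

/-- Adjacency of `within G W` is decided classically (one fixed instance for the whole
development). [folklore] -/
noncomputable instance within.decRel (G : SimpleGraph (Fin k)) (W : Finset (Fin k)) :
    DecidableRel (within G W).Adj := Classical.decRel _

/-- Unfolding `within`. [folklore] -/
@[simp] theorem within_adj {G : SimpleGraph (Fin k)} {W : Finset (Fin k)} {u v : Fin k} :
    (within G W).Adj u v ↔ u ∈ W ∧ v ∈ W ∧ G.Adj u v := by
  simp [within]

/-- The lifted colouring: `c v + 1` on `W`, the reserved colour `0` off `W`. [folklore] -/
def liftCol (W : Finset (Fin k)) (c : Fin k → ℕ) : Fin k → ℕ := fun v => if v ∈ W then c v + 1 else 0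

/-- Value on `W`. [folklore] -/
@[simp] theorem liftCol_of_mem {W : Finset (Fin k)} (c : Fin k → ℕ) {v : Fin k} (hv : v ∈ W) :
    liftCol W c v = c v + 1 := if_pos hv

/-- Value off `W`. [folklore] -/
@[simp] theorem liftCol_of_not_mem {W : Finset (Fin k)} (c : Fin k → ℕ) {v : Fin k} (hv : v ∉ W) :
    liftCol W c v = 0 := if_neg hv

/-- On `W` the lifted colouring has the kernel of `c`. [folklore] -/
theorem liftCol_eq_liftCol_iff {W : Finset (Fin k)} {c : Fin k → ℕ} {u v : Fin k} (hu : u ∈ W) (hv : v ∈ W) :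
    liftCol W c u = liftCol W c v ↔ c u = c v := by
  simp [liftCol_of_mem c hu, liftCol_of_mem c hv]

/-- A vertex with the lifted colour of a vertex of `W` lies in `W`. [folklore] -/
theorem mem_of_liftCol_eq {W : Finset (Fin k)} {c : Fin k → ℕ} {u v : Fin k} (hv : v ∈ W)
    (h : liftCol W c u = liftCol W c v) : u ∈ W := by
  by_contra hu
  rw [liftCol_of_not_mem c hu, liftCol_of_mem c hv] at h
  exact Nat.succ_ne_zero _ h.symm

/-- The cell of `v` in the state `(W, c)`: the vertices of `W` coloured `c v`. [folklore] -/
def cell (W : Finset (Fin k)) (c : Fin k → ℕ) (v : Fin k) : Finset (Fin k) := W.filter fun w => c w = c v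

/-- Membership in a cell. [folklore] -/
@[simp] theorem mem_cell {W : Finset (Fin k)} {c : Fin k → ℕ} {v w : Fin k} : w ∈ cell W c v ↔ w ∈ W ∧ c w = c v :=
  mem_filter

/-- Cells lie in `W`. [folklore] -/
theorem cell_subset (W : Finset (Fin k)) (c : Fin k → ℕ) (v : Fin k) : cell W c v ⊆ W := filter_subset _ _
/-- A vertex of `W` lies in its cell. [folklore] -/
theorem mem_cell_self {W : Finset (Fin k)} (c : Fin k → ℕ) {v : Fin k} (hv : v ∈ W) : v ∈ cell W c v :=
  mem_cell.2 ⟨hv, rfl⟩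

/-- Vertices of the same colour have the same cell. [folklore] -/
theorem cell_eq_cell_of_eq {W : Finset (Fin k)} {c : Fin k → ℕ} {v w : Fin k} (h : c v = c w) : cell W c v = cell W c w := by
  ext x; simp [h]

/-- The whole-type colour class of a lifted colour of `W` is the cell. [folklore] -/
theorem filter_liftCol_eq {W : Finset (Fin k)} (c : Fin k → ℕ) {v : Fin k} (hv : v ∈ W) :
    (univ.filter fun w => liftCol W c w = liftCol W c v) = cell W c v := by
  ext w
  simp only [mem_filter, mem_univ, true_and, mem_cell]
  constructor
  · intro h
    have hw := mem_of_liftCol_eq hv h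
    exact ⟨hw, (liftCol_eq_liftCol_iff hw hv).1 h⟩
  · rintro ⟨hw, h⟩
    exact (liftCol_eq_liftCol_iff hw hv).2 h

/-- Hence `cellCard (liftCol W c) (liftCol W c v) = |cell W c v|` for `v ∈ W`. [folklore] -/
theorem cellCard_liftCol {W : Finset (Fin k)} (c : Fin k → ℕ) {v : Fin k} (hv : v ∈ W) :
    cellCard (liftCol W c) (liftCol W c v) = (cell W c v).card := by
  unfold cellCard; rw [filter_liftCol_eq c hv]

/-! ### Equitable states and the switched graph -/

/-- The state `(W, c)` is **equitable**: the lifted colouring is an equitable colouring of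
`within G W` — i.e. any two vertices of `W` of the same colour have the same number of
neighbours in every cell (vertices off `W` are isolated and form one class). [cite: Laubner2011, Def. 3.2.7] -/
def IsEqui (G : SimpleGraph (Fin k)) (W : Finset (Fin k)) (c : Fin k → ℕ) : Prop :=
  IsEquitable (within G W) (liftCol W c)

/-- The **switched graph of the state** `(W, c)`: the switching-equivalent graph
([Laubner2011, Def. 3.3.2]) of `within G W` for the lifted colouring. [cite: Laubner2011, Def. 3.3.2] -/
def swG (G : SimpleGraph (Fin k)) (W : Finset (Fin k)) (c : Fin k → ℕ) : SimpleGraph (Fin k) :=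
  swGraph (within G W) (liftCol W c)

variable {G : SimpleGraph (Fin k)} {W : Finset (Fin k)} {c : Fin k → ℕ}

/-- No block against the reserved colour `0` is switched (there are no edges off `W`). [folklore] -/
theorem not_switch_zero (d : ℕ) : ¬ Switch (within G W) (liftCol W c) 0 d := by
  unfold Switch crossEdges
  rw [filter_eq_empty_iff.2, card_empty, Nat.mul_zero]
  · exact Nat.not_lt_zero _
  · rintro ⟨u, w⟩ - ⟨hu, -, hadj⟩
    have hu' : u ∈ W := (within_adj.1 hadj).1
    rw [liftCol_of_mem c hu'] at hu
    exact Nat.succ_ne_zero _ hu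

/-- **The switched graph lives on `W`.** [folklore] -/
theorem swG_mem {u v : Fin k} (h : (swG G W c).Adj u v) : u ∈ W ∧ v ∈ W := by
  have key : ∀ {a b : Fin k}, (swG G W c).Adj a b → a ∈ W := by
    intro a b hab
    by_contra ha
    rw [swG, swGraph_adj, liftCol_of_not_mem c ha] at hab
    have h1 : ¬ (within G W).Adj a b := fun h' => ha (within_adj.1 h').1
    exact (h1 (hab.2.2 (not_switch_zero _)))
  exact ⟨key h, key h.symm⟩

/-- Unfolding `swG` between vertices of `W`: `u ~ v` in the switched graph iff `u ≠ v` and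
(`u ~ v` in `G` iff the block of their colours is not switched). [cite: Laubner2011, Def. 3.3.2] -/
theorem swG_adj_iff {u v : Fin k} (hu : u ∈ W) (hv : v ∈ W) :
    (swG G W c).Adj u v ↔ u ≠ v ∧ (G.Adj u v ↔ ¬ Switch (within G W) (liftCol W c) (liftCol W c u) (liftCol W c v)) := by
  rw [swG, swGraph_adj, within_adj]
  simp [hu, hv]

/-- **Across a non-edge of the switched graph, adjacency in `G` is the switch bit of the two
colours.** [cite: Laubner2011, Prop. 3.3.4 (proof)] -/
theorem adj_iff_switch_of_not_adj {u v : Fin k} (hu : u ∈ W) (hv : v ∈ W) (hne : u ≠ v)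
    (h : ¬ (swG G W c).Adj u v) :
    G.Adj u v ↔ Switch (within G W) (liftCol W c) (liftCol W c u) (liftCol W c v) := by
  rw [swG_adj_iff hu hv] at h
  tauto

/-- A subset `C ⊆ W` is **closed** if no edge of the switched graph leaves it — a union of
connected components of `swG` on `W`. [cite: Laubner2011, Prop. 3.3.4] -/
def IsClosed (G : SimpleGraph (Fin k)) (W : Finset (Fin k)) (c : Fin k → ℕ) (C : Finset (Fin k)) : Prop :=
  C ⊆ W ∧ ∀ ⦃u v : Fin k⦄, u ∈ C → (swG G W c).Adj u v → v ∈ C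

/-- **Homogeneity across a closed set**: a vertex of `W` outside a closed `C` is adjacent in `G`
to all or to none of the vertices of `C` of any given colour. [cite: Laubner2011, Prop. 3.3.4] -/
theorem adj_iff_adj_of_closed {C : Finset (Fin k)} (hC : IsClosed G W c C) {u v w : Fin k} (hu : u ∈ W) (huC : u ∉ C)
    (hv : v ∈ C) (hw : w ∈ C) (hcol : c v = c w) : G.Adj u v ↔ G.Adj u w := by
  have hv' := hC.1 hv
  have hw' := hC.1 hw
  have h1 : ¬ (swG G W c).Adj u v := fun h => huC (hC.2 hv h.symm)
  have h2 : ¬ (swG G W c).Adj u w := fun h => huC (hC.2 hw h.symm)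
  rw [adj_iff_switch_of_not_adj hu hv' (fun e => huC (e ▸ hv)) h1,
    adj_iff_switch_of_not_adj hu hw' (fun e => huC (e ▸ hw)) h2,
    liftCol_of_mem c hv', liftCol_of_mem c hw', hcol]

/-- The complement in `W` of a closed set is closed. [folklore] -/
theorem IsClosed.sdiff {C : Finset (Fin k)} (hC : IsClosed G W c C) : IsClosed G W c (W \ C) := by
  refine ⟨sdiff_subset, fun u v hu huv => ?_⟩
  rw [mem_sdiff] at hu ⊢
  exact ⟨(swG_mem huv).2, fun hv => hu.2 (hC.2 hv huv.symm)⟩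

/-! ### Components -/

/-- The state is **connected**: the switched graph is connected on `W`. [cite: Laubner2011, §3.4] -/
def IsConn (G : SimpleGraph (Fin k)) (W : Finset (Fin k)) (c : Fin k → ℕ) : Prop :=
  ∀ ⦃u⦄, u ∈ W → ∀ ⦃v⦄, v ∈ W → (swG G W c).Reachable u v

/-- The **component** of `u` in the switched graph, as a finset of vertices of `W`. [cite: Laubner2011, Prop. 3.3.4] -/
def comp (G : SimpleGraph (Fin k)) (W : Finset (Fin k)) (c : Fin k → ℕ) (u : Fin k) : Finset (Fin k) :=
  W.filter fun v => (swG G W c).Reachable u v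

/-- Membership in a component. [folklore] -/
theorem mem_comp {u v : Fin k} : v ∈ comp G W c u ↔ v ∈ W ∧ (swG G W c).Reachable u v := by
  simp [comp]

/-- Components lie in `W`. [folklore] -/
theorem comp_subset (u : Fin k) : comp G W c u ⊆ W := filter_subset _ _
/-- A vertex of `W` lies in its component. [folklore] -/
theorem mem_comp_self {u : Fin k} (hu : u ∈ W) : u ∈ comp G W c u := mem_comp.2 ⟨hu, SimpleGraph.Reachable.refl _⟩

/-- Components of vertices in the same component coincide. [folklore] -/
theorem comp_eq_of_mem {u v : Fin k} (hv : v ∈ comp G W c u) : comp G W c v = comp G W c u := by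
  ext w
  rw [mem_comp, mem_comp]
  obtain ⟨-, huv⟩ := mem_comp.1 hv
  exact ⟨fun ⟨hw, h⟩ => ⟨hw, huv.trans h⟩, fun ⟨hw, h⟩ => ⟨hw, huv.symm.trans h⟩⟩

/-- **Components are closed.** [cite: Laubner2011, Prop. 3.3.4] -/
theorem comp_closed (u : Fin k) : IsClosed G W c (comp G W c u) := by
  refine ⟨comp_subset u, fun v w hv hvw => ?_⟩
  rw [mem_comp] at hv ⊢
  exact ⟨(swG_mem hvw).2, hv.2.trans hvw.reachable⟩

/-- A walk of the switched graph starting in `W` stays in `W`. [folklore] -/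
theorem mem_of_reachable {u v : Fin k} (hu : u ∈ W) (h : (swG G W c).Reachable u v) : v ∈ W := by
  obtain ⟨p⟩ := h
  induction p with
  | nil => exact hu
  | cons hadj _ ih => exact ih (swG_mem hadj).2

/-- In a connected state every component is all of `W`. [folklore] -/
theorem comp_eq_of_isConn (h : IsConn G W c) {u : Fin k} (hu : u ∈ W) : comp G W c u = W := by
  ext v
  rw [mem_comp]
  exact ⟨fun hv => hv.1, fun hv => ⟨hv, h hu hv⟩⟩

/-- If a component is a proper subset of `W` then so is every component. [folklore] -/
theorem comp_ssubset_of_not_isConn (h : ¬ IsConn G W c) (u : Fin k) : comp G W c u ⊂ W := by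
  refine (comp_subset u).ssubset_of_ne fun e => h ?_
  intro a ha b hb
  have ha' : (swG G W c).Reachable u a := (mem_comp.1 (e.symm ▸ ha)).2
  have hb' : (swG G W c).Reachable u b := (mem_comp.1 (e.symm ▸ hb)).2
  exact ha'.symm.trans hb'

/-! ### Equitable states: restriction, half-degrees, singleton cells -/

/-- Neighbour counts of the lifted colouring inside `W`, as a filter of a cell. [folklore] -/
theorem adjCount_liftCol (H : SimpleGraph (Fin k)) [DecidableRel H.Adj] (hH : ∀ {a b : Fin k}, H.Adj a b → a ∈ W ∧ b ∈ W) {v : Fin k}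
    (hv : v ∈ W) (u : Fin k) :
    adjCount H (liftCol W c) u (liftCol W c v) = ((cell W c v).filter fun w => H.Adj u w).card := by
  unfold adjCount
  congr 1
  ext w
  simp only [mem_filter, mem_univ, true_and, mem_cell]
  constructor
  · rintro ⟨hadj, hcol⟩
    have hw := (hH hadj).2
    exact ⟨⟨hw, (liftCol_eq_liftCol_iff hw hv).1 hcol⟩, hadj⟩
  · rintro ⟨⟨hw, hcol⟩, hadj⟩
    exact ⟨hadj, (liftCol_eq_liftCol_iff hw hv).2 hcol⟩

/-- **Equitability on `W`, unfolded**: two vertices of `W` of the same colour have the same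
number of `G`-neighbours in every cell. [cite: Laubner2011, Def. 3.2.7] -/
theorem IsEqui.card_filter_adj_eq (h : IsEqui G W c) {u u' v : Fin k} (hu : u ∈ W) (hu' : u' ∈ W) (hv : v ∈ W)
    (hcol : c u = c u') :
    ((cell W c v).filter fun w => G.Adj u w).card = ((cell W c v).filter fun w => G.Adj u' w).card := by
  have key := h.adjCount_eq ((liftCol_eq_liftCol_iff hu hu').2 hcol) (liftCol W c v)
  rw [adjCount_liftCol (within G W) (fun hab => ⟨(within_adj.1 hab).1, (within_adj.1 hab).2.1⟩) hv,
    adjCount_liftCol (within G W) (fun hab => ⟨(within_adj.1 hab).1, (within_adj.1 hab).2.1⟩) hv] at key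
  have e : ∀ a ∈ W, ((cell W c v).filter fun w => (within G W).Adj a w) = (cell W c v).filter fun w => G.Adj a w := by
    intro a ha
    ext w
    simp only [mem_filter, mem_cell, within_adj, and_congr_right_iff]
    exact fun hw => ⟨fun h => h.2.2, fun h => ⟨ha, hw.1, h⟩⟩
  rwa [e u hu, e u' hu'] at key

/-- **A criterion for equitability on `W`** by counting `G`-neighbours in cells. [cite: Laubner2011, Def. 3.2.7] -/
theorem isEqui_of_forall (h : ∀ ⦃u u' v : Fin k⦄, u ∈ W → u' ∈ W → v ∈ W → c u = c u' →
      ((cell W c v).filter fun w => G.Adj u w).card = ((cell W c v).filter fun w => G.Adj u' w).card) :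
    IsEqui G W c := by
  intro u u' huu' y
  rw [Nat.card_eq_fintype_card, Fintype.card_subtype, Nat.card_eq_fintype_card, Fintype.card_subtype]
  by_cases hu : u ∈ W
  · have hu' : u' ∈ W := mem_of_liftCol_eq hu huu'.symm
    have hcol : c u = c u' := (liftCol_eq_liftCol_iff hu hu').1 huu'
    by_cases hy : ∃ v ∈ W, liftCol W c v = y
    · obtain ⟨v, hv, rfl⟩ := hy
      change adjCount (within G W) (liftCol W c) u (liftCol W c v) = adjCount (within G W) (liftCol W c) u' (liftCol W c v)
      rw [adjCount_liftCol (within G W) (fun hab => ⟨(within_adj.1 hab).1, (within_adj.1 hab).2.1⟩) hv,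
        adjCount_liftCol (within G W) (fun hab => ⟨(within_adj.1 hab).1, (within_adj.1 hab).2.1⟩) hv]
      have e : ∀ a ∈ W, ((cell W c v).filter fun w => (within G W).Adj a w) = (cell W c v).filter fun w => G.Adj a w := by
        intro a ha
        ext w
        simp only [mem_filter, mem_cell, within_adj, and_congr_right_iff]
        exact fun hw => ⟨fun h => h.2.2, fun h => ⟨ha, hw.1, h⟩⟩
      rw [e u hu, e u' hu']
      exact h hu hu' hv hcol
    · push Not at hy
      have e : ∀ a : Fin k, (univ.filter fun w => (within G W).Adj a w ∧ liftCol W c w = y) = ∅ := by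
        intro a
        refine filter_eq_empty_iff.2 fun w _ hw => hy w (within_adj.1 hw.1).2.1 hw.2
      rw [e u, e u']
  · have hu' : u' ∉ W := fun hu' => hu (mem_of_liftCol_eq hu' huu')
    have e : ∀ a : Fin k, a ∉ W → (univ.filter fun w => (within G W).Adj a w ∧ liftCol W c w = y) = ∅ := by
      intro a ha
      refine filter_eq_empty_iff.2 fun w _ hw => ha (within_adj.1 hw.1).1
    rw [e u hu, e u' hu']

/-- **Equitability restricts to closed sets**: on a closed `C ⊆ W` (a union of components of
the switched graph) the colouring is again equitable — every vertex of `C` of a given colour is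
homogeneous to the cells of `W ∖ C`, uniformly. [cite: Laubner2011, §3.4 (sections of stable colourings are stable)] -/
theorem IsEqui.of_closed (h : IsEqui G W c) {C : Finset (Fin k)} (hC : IsClosed G W c C) : IsEqui G C c := by
  refine isEqui_of_forall fun u u' v hu hu' hv hcol => ?_
  have hD := hC.sdiff
  -- the `G`-neighbours of `u` in `cell W c v` split as those in `C` and those in `W \ C`
  have split : ∀ a ∈ C, ((cell W c v).filter fun w => G.Adj a w).card =
      ((cell C c v).filter fun w => G.Adj a w).card + (((W \ C).filter fun w => c w = c v).filter fun w => G.Adj a w).card := by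
    intro a ha
    rw [← card_union_of_disjoint]
    · congr 1
      ext w
      simp only [mem_filter, mem_cell, mem_union, mem_sdiff]
      constructor
      · rintro ⟨⟨hw, hcw⟩, hadj⟩
        by_cases hwC : w ∈ C
        · exact Or.inl ⟨⟨hwC, hcw⟩, hadj⟩
        · exact Or.inr ⟨⟨⟨hw, hwC⟩, hcw⟩, hadj⟩
      · rintro (⟨⟨hwC, hcw⟩, hadj⟩ | ⟨⟨⟨hw, -⟩, hcw⟩, hadj⟩)
        · exact ⟨⟨hC.1 hwC, hcw⟩, hadj⟩
        · exact ⟨⟨hw, hcw⟩, hadj⟩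
    · rw [disjoint_left]
      intro w hw hw'
      simp only [mem_filter, mem_cell, mem_sdiff] at hw hw'
      exact hw'.1.1.2 hw.1.1
  -- the second summand is `0` or everything, uniformly in `a ∈ C` of colour `c u`
  have homog : ∀ a ∈ C, c a = c u → (((W \ C).filter fun w => c w = c v).filter fun w => G.Adj a w) =
      (((W \ C).filter fun w => c w = c v).filter fun w => G.Adj u w) := by
    intro a ha hca
    ext w
    simp only [mem_filter, mem_sdiff, and_congr_right_iff]
    rintro ⟨⟨hw, hwC⟩, -⟩
    -- both `a` and `u` are outside the closed set `W \ C` relative to... use closedness of `C` from `w`'s side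
    have h1 : G.Adj w a ↔ G.Adj w u :=
      adj_iff_adj_of_closed hC hw hwC ha hu hca
    rw [G.adj_comm a w, G.adj_comm u w, h1]
  have key := h.card_filter_adj_eq (hC.1 hu) (hC.1 hu') (hC.1 hv) hcol
  rw [split u hu, split u' hu', homog u' hu' hcol.symm] at key
  omega

/-- **Half-degrees in the switched graph**: a vertex of `W` is `swG`-adjacent to at most half of
every cell (the switching rule; [Laubner2011, §3.3.2]). [cite: Laubner2011, §3.3.2] -/
theorem IsEqui.two_mul_card_filter_adj_le (h : IsEqui G W c) (u : Fin k) {v : Fin k} (hv : v ∈ W) :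
    2 * ((cell W c v).filter fun w => (swG G W c).Adj u w).card ≤ (cell W c v).card := by
  have key := halfBounded_swGraph h u (liftCol W c v)
  rw [adjCount_liftCol (swGraph (within G W) (liftCol W c)) (fun hab => swG_mem hab) hv, cellCard_liftCol c hv] at key
  convert key using 3
  exact filter_congr fun w _ => Iff.rfl

/-- **Singleton cells are isolated in the switched graph** (a singleton cell is uniformly
adjacent to every cell, so every block against it is empty after switching). [cite: Laubner2011, §3.4] -/
theorem IsEqui.not_adj_of_card_cell_eq_one (h : IsEqui G W c) {u v : Fin k} (hu : u ∈ W) (h1 : (cell W c u).card = 1) :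
    ¬ (swG G W c).Adj u v := by
  intro hadj
  have hv : v ∈ W := (swG_mem hadj).2
  -- `v` sees at most half of the singleton cell `{u}`, i.e. nothing
  have key := h.two_mul_card_filter_adj_le v hu
  rw [h1] at key
  have hmem : u ∈ (cell W c u).filter fun w => (swG G W c).Adj v w := mem_filter.2 ⟨mem_cell_self c hu, hadj.symm⟩
  have : 1 ≤ ((cell W c u).filter fun w => (swG G W c).Adj v w).card := card_pos.2 ⟨u, hmem⟩
  omega

/-- **In a connected equitable state with at least two vertices every cell has at least two
elements** (a singleton cell would be an isolated vertex of the switched graph). [cite: Laubner2011, §3.4] -/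
theorem IsEqui.two_le_card_cell (h : IsEqui G W c) (hconn : IsConn G W c) (hW : 2 ≤ W.card) {u : Fin k} (hu : u ∈ W) :
    2 ≤ (cell W c u).card := by
  by_contra hlt
  have h1 : (cell W c u).card = 1 := by
    have : 1 ≤ (cell W c u).card := card_pos.2 ⟨u, mem_cell_self c hu⟩
    omega
  -- pick `v ≠ u` in `W`; a walk from `u` to `v` starts with an edge at `u`
  obtain ⟨v, hv, hvu⟩ : ∃ v ∈ W, v ≠ u := by
    by_contra hno
    push Not at hno
    have : W ⊆ {u} := fun w hw => mem_singleton.2 (hno w hw)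
    have := card_le_card this
    rw [card_singleton] at this
    omega
  obtain ⟨p⟩ := hconn hu hv
  cases p with
  | nil => exact hvu rfl
  | cons hadj _ => exact h.not_adj_of_card_cell_eq_one hu h1 hadj

end CGCanon

end

end Literature.Computability.Complexity
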